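import Mathlib
import HarnessLib
import Literature.Analysis.FluidPDE.TypeIAncientMild
import Literature.Analysis.FluidPDE.LerayProfileCalculus
import Literature.Analysis.FluidPDE.TsaiMaximumPrinciple
import Summits.NavierStokesRegularity.NavierStokesRegularity.Theorems.AdaptedFrequencyTangentFlowTransferAncientPressure

/-!
# Route `PoloidalWindowDoor`, crux `PoloidalWindowRigidity` (K2, stmt-NavierStokesRegularity-19708) —
# FIRST-ORDER CONDITIONS AT THE HOT SPOT of a profile attaining its Type-I bound (toolkit for the residue S2′)

Cell ns-regularity-ideate, K2 lead ns-poloidal-K2-p1 (support file, `--supports stmt-…-19708 --as helper`; task (H1e)).  The normal form of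
the K2 line (`…PoloidalExtremal` p469616, `…PoloidalExtremalRecurrent` p471740) hands the residue prover a profile `W ∈ 𝔓(C⋆)` with
`‖W(−1,0)‖ = C⋆`; the first-order conditions at such a HOT SPOT (route `ExtremalTypeIConstant`, item `HotSpotFirstOrder`, proved there under an
extra — unused — full-class minimality clause) hold for ANY element of a KNSS Type-I class attaining its bound at `(−1,0)`:
`∇ₓ‖u(−1,·)‖²(0) = 0`, `∂ₜ‖u(·,0)‖²(−1) = C²`, `Δₓ‖u(−1,·)‖²(0) ≤ 0`, and, with the class pressure `p`
(`exists_isClassicalNSSolutionOn_Iio_of_isTypeIAncientMild`), `C²/2 + |∇u(−1,0)|² ≤ −⟪u(−1,0), ∇p(−1,0)⟫` — the pressure gradient must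
PUSH at the hot spot.  This is the form the sub-class-extremal poloidal profile satisfies (no full-class minimality needed).

* `hotSpot_firstOrder` — the four conditions.

WHAT THIS IS NOT: not a claim about Navier–Stokes regularity and not the residue — a reusable calculus lemma (bears_on LADDER-NS N0,
rung N0-LocalTubeDoorPoloidal).
-/

noncomputable section

-- the summit and its single sub-problem share the name (CONVENTIONS §1), as in every Theorems file
set_option linter.dupNamespace false

namespace Summit.NavierStokesRegularity.NavierStokesRegularity.Theorems.PoloidalWindowDoorPoloidalWindowRigidityHotSpot

open MeasureTheory Set Function Filter Topology
open scoped RealInnerProductSpace Laplacian ContDiff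
open Literature.Analysis Literature.Analysis.FluidPDE
open Summit.NavierStokesRegularity.NavierStokesRegularity.Theorems

/-- **First-order conditions at a hot spot.**  If `u ∈ 𝔓(C)` (`IsTypeIAncientMild C u`) attains its Type-I bound at `(−1,0)`,
`‖u(−1,0)‖ = C`, then `∇ₓ‖u(−1,·)‖²(0) = 0`, `∂ₜ‖u(·,0)‖²(−1) = C²`, `Δₓ‖u(−1,·)‖²(0) ≤ 0`, and for the class pressure `p`
(`(u,p)` classical on `t < 0`), `C²/2 + |∇u(−1,0)|² ≤ −⟪u(−1,0), ∇p(−1,0)⟫`. -/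
theorem hotSpot_firstOrder {C : ℝ} {u : ℝ → EuclideanSpace ℝ (Fin 3) → EuclideanSpace ℝ (Fin 3)}
    (hA : IsTypeIAncientMild C u) (hnorm : ‖u (-1) 0‖ = C) :
    fderiv ℝ (fun x => ‖u (-1) x‖ ^ 2) 0 = 0 ∧
      deriv (fun t => ‖u t 0‖ ^ 2) (-1) = C ^ 2 ∧
      (Δ (fun x => ‖u (-1) x‖ ^ 2)) 0 ≤ 0 ∧
      ∃ p : ℝ → EuclideanSpace ℝ (Fin 3) → ℝ, IsClassicalNSSolutionOn (Iio 0) 1 0 u p ∧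
        C ^ 2 / 2 + frobeniusNormSq (fderiv ℝ (u (-1)) 0) ≤ -⟪u (-1) 0, gradient (p (-1)) 0⟫ := by
  have hA' : IsTypeIAncientMild C u := hA
  obtain ⟨hsm, -, -, hdecay⟩ := hA
  -- the slice `u(-1, ·)` is smooth
  have hslice : ContDiff ℝ ∞ (u (-1)) :=
    IsSmoothSpaceTimeOn.contDiff_slice (S := Iio 0) (w := u) hsm (show (-1 : ℝ) < 0 by norm_num)
  have hslice2 : ContDiff ℝ 2 (u (-1)) := hslice.of_le (by norm_cast)
  -- (a), (c): `x ↦ ‖u(-1,x)‖²` has a global maximum at `x = 0`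
  have hbound1 : ∀ x, ‖u (-1) x‖ ≤ C := fun x => by
    have h := hdecay (-1) (by norm_num) x
    simpa using h
  have hgmax : IsLocalMax (fun x => ‖u (-1) x‖ ^ 2) 0 :=
    Filter.Eventually.of_forall fun x => by
      show ‖u (-1) x‖ ^ 2 ≤ ‖u (-1) 0‖ ^ 2
      rw [hnorm]
      exact pow_le_pow_left₀ (norm_nonneg _) (hbound1 x) 2
  have ha : fderiv ℝ (fun x => ‖u (-1) x‖ ^ 2) 0 = 0 := hgmax.fderiv_eq_zero
  have hc : (Δ (fun x => ‖u (-1) x‖ ^ 2)) 0 ≤ 0 := laplacian_nonpos_of_isLocalMax (hslice2.norm_sq ℝ) hgmax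
  -- (b): `s ↦ (-s) ‖u(s,0)‖²` has a local maximum at `s = -1`
  have hline : HasDerivAt (fun s => u s 0) (deriv (fun s => u s 0) (-1)) (-1) := by
    have hopen : IsOpen (Iio (0 : ℝ) ×ˢ (univ : Set (EuclideanSpace ℝ (Fin 3)))) := isOpen_Iio.prod isOpen_univ
    have hct : ContDiffAt ℝ (⊤ : ℕ∞) (uncurry u) ((-1 : ℝ), (0 : EuclideanSpace ℝ (Fin 3))) :=
      hsm.contDiffAt (hopen.mem_nhds ⟨by norm_num, mem_univ _⟩)
    have hd : DifferentiableAt ℝ (uncurry u) ((-1 : ℝ), (0 : EuclideanSpace ℝ (Fin 3))) := hct.differentiableAt (by simp)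
    have hl : DifferentiableAt ℝ (fun s : ℝ => ((s, (0 : EuclideanSpace ℝ (Fin 3))) : ℝ × EuclideanSpace ℝ (Fin 3))) (-1) :=
      differentiableAt_id.prodMk (differentiableAt_const _)
    exact (hd.comp (-1) hl).hasDerivAt
  have hh : HasDerivAt (fun s => ‖u s 0‖ ^ 2) (2 * ⟪u (-1) 0, deriv (fun s => u s 0) (-1)⟫) (-1) := hline.norm_sq
  have hFmax : IsLocalMax (fun s : ℝ => -s * ‖u s 0‖ ^ 2) (-1) := by
    filter_upwards [Iio_mem_nhds (show (-1 : ℝ) < 0 by norm_num)] with s hs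
    have hs' : s < 0 := hs
    have hpos : 0 < -s := neg_pos.2 hs'
    have hsq : ‖u s 0‖ ^ 2 ≤ C ^ 2 / (-s) := by
      have h1 := hdecay s hs' 0
      have h2 : ‖u s 0‖ ^ 2 ≤ (C / Real.sqrt (-s)) ^ 2 := pow_le_pow_left₀ (norm_nonneg _) h1 2
      rwa [div_pow, Real.sq_sqrt hpos.le] at h2
    calc -s * ‖u s 0‖ ^ 2 ≤ -s * (C ^ 2 / (-s)) := mul_le_mul_of_nonneg_left hsq hpos.le
      _ = C ^ 2 := by
          have hne : s ≠ 0 := hs'.ne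
          field_simp
      _ = -(-1) * ‖u (-1) 0‖ ^ 2 := by rw [hnorm]; ring
  have hF : HasDerivAt (fun s : ℝ => -s * ‖u s 0‖ ^ 2)
      (-1 * ‖u (-1) 0‖ ^ 2 + -(-1) * (2 * ⟪u (-1) 0, deriv (fun s => u s 0) (-1)⟫)) (-1) :=
    (hasDerivAt_neg' (-1 : ℝ)).mul hh
  have hzero := hFmax.hasDerivAt_eq_zero hF
  have hUd : 2 * ⟪u (-1) 0, deriv (fun s => u s 0) (-1)⟫ = C ^ 2 := by
    rw [hnorm] at hzero
    linarith
  -- (d): one pressure on the whole slab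
  obtain ⟨p, hp⟩ := exists_isClassicalNSSolutionOn_Iio_of_isTypeIAncientMild hA'
  refine ⟨ha, ?_, hc, p, hp, ?_⟩
  · rw [hh.deriv, hUd]
  · -- the pressure push: pair the momentum equation at `(-1, 0)` with `u(-1, 0)`
    have hmom := hp.momentum (-1) (show (-1 : ℝ) < 0 by norm_num) 0
    have htd : timeDerivWithin (Iio 0) u (-1) 0 = deriv (fun s => u s 0) (-1) := by
      rw [timeDerivWithin_apply, derivWithin_of_mem_nhds (Iio_mem_nhds (by norm_num))]
    rw [htd, convect_apply, one_smul, Pi.zero_apply, Pi.zero_apply, add_zero] at hmom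
    -- `⟪u, Du[u]⟫ = ½ D‖u‖²[u] = 0` at the hot spot
    have hUA : ⟪u (-1) 0, fderiv ℝ (u (-1)) 0 (u (-1) 0)⟫ = 0 := by
      have hdiff : DifferentiableAt ℝ (u (-1)) 0 := hslice.differentiable (by simp) 0
      have h1 := hdiff.hasFDerivAt.norm_sq
      have h0 : HasFDerivAt (fun x => ‖u (-1) x‖ ^ 2) (0 : EuclideanSpace ℝ (Fin 3) →L[ℝ] ℝ) 0 := by
        have h := h1.differentiableAt.hasFDerivAt
        rwa [ha] at h
      have heq := h1.unique h0
      have h3 := congrArg (fun L : EuclideanSpace ℝ (Fin 3) →L[ℝ] ℝ => L (u (-1) 0)) heq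
      simp only [FunLike.coe_smul, ContinuousLinearMap.coe_comp, Pi.smul_apply,
        Function.comp_apply, innerSL_apply_apply, FunLike.coe_zero, Pi.zero_apply,
        nsmul_eq_mul, Nat.cast_ofNat] at h3
      linarith
    -- `Δ‖u‖² = 2⟪Δu, u⟫ + 2|Du|²` and `Δ‖u‖²(0) ≤ 0`
    have hlap := laplacian_inner_self_eq hslice2 (0 : EuclideanSpace ℝ (Fin 3))
    have hfun : (fun y => ⟪u (-1) y, u (-1) y⟫) = fun x => ‖u (-1) x‖ ^ 2 :=
      funext fun y => real_inner_self_eq_norm_sq _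
    rw [hfun] at hlap
    have hcomm : ⟪(Δ (u (-1))) 0, u (-1) 0⟫ = ⟪u (-1) 0, (Δ (u (-1))) 0⟫ := by rw [real_inner_comm]
    have hUL : ⟪u (-1) 0, (Δ (u (-1))) 0⟫ ≤ -frobeniusNormSq (fderiv ℝ (u (-1)) 0) := by
      linarith [hc, hlap, hcomm]
    have key : ⟪u (-1) 0, deriv (fun s => u s 0) (-1)⟫ + ⟪u (-1) 0, fderiv ℝ (u (-1)) 0 (u (-1) 0)⟫ =
        ⟪u (-1) 0, (Δ (u (-1))) 0⟫ - ⟪u (-1) 0, gradient (p (-1)) 0⟫ := by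
      rw [← inner_add_right, ← inner_sub_right, hmom]
    linarith [hUd, hUA, hUL, key]

end Summit.NavierStokesRegularity.NavierStokesRegularity.Theorems.PoloidalWindowDoorPoloidalWindowRigidityHotSpot
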